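import Summits.BirchSwinnertonDyer.BirchSwinnertonDyer.Theorems.PrintX11aUpperNonSurjThreeSharpLocalMult
import HarnessLib

/-!
# Route `PrintX11a`, child crux U3 = `PrintX11a.UpperNonSurjThree` (item stmt-BirchSwinnertonDyer-20613),
# line «finemu3» — ♯-road LOCAL FINITENESS IIb: **`E(K_{v,∞})[p^∞] = E(K_v)[p^∞]` at a split multiplicative place with
# `μ_p(K_v) = 1`, for EVERY elliptic curve and EVERY `ℤ_p`-extension** — the tame hypothesis of `…SharpLocalMult`
# (p617184) REMOVED: the `μ_p`-line `Φ(μ_p)` is always tame (`σζ = ζ^c`, so `σ^{p-1}` fixes it)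
# (cell `bsd-print-x11a`, width seat `bsd-line-x11a-p1-w2` gen 2; `--supports` 20613; closes nothing)

HONEST FRAMING.  BSD is not proved by any of this; nothing is asserted about any curve; the crux stays as the lead registered it
(finemu3 r4: reduced to item 19949).  THEOREMS ONLY (no definition, no named fact, no `sorry`), all PROVED from tree theorems.

WHAT.  `…SharpLocalMult` proved `E[p^∞]^{Gal(K̄/K_∞) ⊓ D_v} = E[p^∞]^{D_v}` at a split multiplicative `v` with `μ_p(K_v) = 1` under
a TAME EXPONENT on `E[p]` at `D_v` (automatic on the small-image locus, false for a surjective `ρ̄_{E,p}`).  The exponent was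
used only on the `p`-torsion of the `μ`-line `A = Φ⁻¹(μ_{p^∞})`, i.e. on `Φ(ζ)` with `ζ ∈ μ_p`, where it ALWAYS holds: for
`σ ∈ Γ_{K_v}`, `σζ = ζ^c` with `p ∤ c` (`ζ` is a primitive `p`-th root, `σζ ≠ 1`), so `σ^j Φ(ζ) = Φ(ζ^{c^j})` and
`σ^{p-1}` fixes `Φ(ζ)` (`c^{p-1} ≡ 1`), an exponent prime to `p`.  Hence, hypothesis-minimal and for ANY curve:
* `geomPrimaryTorsion_forall_decomp_smul_eq_of_split_any` / `…_iff_of_split_any` — split multiplicative `v`, `μ_p(K_v) = 1`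
  (`∀ ζ ∈ K_v, ζ^p = 1 → ζ = 1`) ⟹ for every `κ`: `E[p^∞]^{ker κ ⊓ D_v} = E[p^∞]^{D_v}` («tower torsion = level-0 torsion»);
  `geomTorsion_fixed_kerSubgroup_inf_decomp_iff_of_split_any` — the same on `E[p]`;
* `exists_kummer_add_hom_of_sharp_clause_of_split_any` — the ♯-clause at such `v` in the explicit form «`y_v = ∂b + χ`»
  (`p·b ∈ E(K_v)[p^∞]`, `χ : D_v → E(K_v)[p]` additive, killing `Gal(K̄_v/K_v K_∞)`) WITHOUT the tame hypothesis (the values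
  of `χ` are `H_v`-fixed points of `E[p] ⊆ E[p^∞]`, hence `D_v`-fixed by the first theorem).
Ingredients: the proof of p617184 verbatim except step (F2) (tree Tate uniformisation `TateCurve.Silverman1994_thmV53_…_holds`,
tame transfer `…SharpTame`, `0 < v(q) < 1 ⟹ (qⁿ = 1 → n = 0)` by `zpow_right_strictAnti₀` on `Valued.v`).  Beneficiaries:
any tree argument on `E(K_{v,∞})[p^∞]` at a split multiplicative place of a `ℤ_p`-extension (e.g. Castella-erratum-type control
at `𝔭 ∣ p` split in an imaginary quadratic field, cell b2b's `X11b.AcSelmer`: there hypothesis (iv) `E(K_𝔭)[p] = 0` kills the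
tower torsion; this file computes it when (iv) fails), beside the x11a ♯-certificates.

References: [SilvermanATAEC1994] Thm. V.3.1 (c)(d), Lemma V.5.2, Thm. V.5.3; [GreenbergLNM1716] §3 Lemmas 3.1, 3.3 and p. 70;
[Serre1972] §1.12 Prop. 13 (`E_q[p]` and the inertia character); [Castella2018Erratum] Thm. 1.1 (iv); [Washington1997] §13.1.
-/

set_option linter.dupNamespace false
set_option autoImplicit false

noncomputable section

open scoped Classical

open WeierstrassCurve Field NumberField IsDedekindDomain
  Literature.NumberTheory.EllipticCurves
  Literature.NumberTheory.EllipticCurves.GreenbergSelmer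
  Literature.NumberTheory.EllipticCurves.Rank1Residual
  Literature.NumberTheory.GaloisRepresentations
  Summit.BirchSwinnertonDyer.Rank1Residual

namespace Summit.BirchSwinnertonDyer.BirchSwinnertonDyer.Theorems.UpperNonSurjThreeSharp

section SplitAny

variable {K : Type} [Field K] [NumberField K] (W : WeierstrassCurve K) [W.IsElliptic] {p : ℕ} [Fact p.Prime]
  (κ : ZpExtension K p)

/-- **TOWER TORSION AT A SPLIT MULTIPLICATIVE PLACE IS LEVEL-0 TORSION — ANY CURVE.**  `K` a number field, `W/K` elliptic,
SPLIT multiplicative at `v`, `μ_p(K_v) = 1` (`∀ ζ ∈ K_v, ζ^p = 1 → ζ = 1`).  Then for EVERY `ℤ_p`-datum `κ` a point of `E[p^∞]`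
fixed by `Gal(K̄/K_∞) ⊓ D_v` is fixed by `D_v` («`E(K_{v,∞})[p^∞] = E(K_v)[p^∞]`»).  Proof = p617184's with the tame step done on
the `μ_p`-line itself: `σζ = ζ^c`, `p ∤ c`, `σ^j Φ(ζ) = Φ(ζ^{c^j})`, `c^{p-1} ≡ 1 (p)` ⟹ `σ^{p-1}` fixes `Φ(ζ)`, an exponent prime
to `p`, so the tame transfer of `…SharpTame` applies. [cite: SilvermanATAEC1994, Thm. V.3.1 (c)(d), Lemma V.5.2, Thm. V.5.3]
[cite: GreenbergLNM1716, §3 Lemma 3.3 and p. 70] [cite: Serre1972, §1.12 Prop. 13] -/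
theorem geomPrimaryTorsion_forall_decomp_smul_eq_of_split_any (v : HeightOneSpectrum (𝓞 K))
    (hsplit : W.HasSplitMultiplicativeReductionAt v)
    (hμ : ∀ ζ : v.adicCompletion K, ζ ^ p = 1 → ζ = 1)
    (P : geomPrimaryTorsion W p) (hP : ∀ τ ∈ κ.kerSubgroup ⊓ decomp v, τ • P = P) :
    ∀ σ ∈ decomp v, σ • P = P := by
  have hp : p.Prime := Fact.out
  haveI : NeZero p := ⟨hp.ne_zero⟩
  set Kv := v.adicCompletion K with hKv
  haveI : CharZero Kv := charZero_adicCompletion v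
  obtain ⟨q, Φ, hq0, hqv1, hsurj, hker, hequiv, hrat⟩ :=
    TateCurve.Silverman1994_thmV53_tateUniformisation_holds W v hsplit
  set L := AlgebraicClosure Kv with hL
  -- the `μ`-line: points of `E[p^∞]` whose image in `E(K̄_v)` is `Φ(ζ)` for a `p`-power root of unity `ζ`
  set A : Set (geomPrimaryTorsion W p) := {x | ∃ ζ : Lˣ, (∃ k : ℕ, (ζ : L) ^ p ^ k = 1) ∧
    pointsMap W Kv (x : geomPoints W) = Φ (Additive.ofMul ζ)} with hA
  -- (F1) `D_v` acts trivially on `E[p^∞]` modulo `A`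
  have hF1 : ∀ d ∈ decomp v, ∀ x : geomPrimaryTorsion W p, d • x - x ∈ A := by
    intro d hd x
    obtain ⟨σ, rfl⟩ := (mem_decomp_iff v d).mp hd
    obtain ⟨k, hk⟩ := x.2
    obtain ⟨a, ha⟩ := hsurj (pointsMap W Kv (x : geomPoints W))
    obtain ⟨u, rfl⟩ : ∃ u : Lˣ, Additive.ofMul u = a := ⟨Additive.toMul a, rfl⟩
    -- `u^{p^k} = q^n`
    have hux : Φ (Additive.ofMul (u ^ p ^ k)) = 0 := by
      have hx0 : (p ^ k • x : geomPrimaryTorsion W p) = 0 := Subtype.ext (by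
        rw [AddSubgroupClass.coe_nsmul, hk]; rfl)
      rw [ofMul_pow, map_nsmul, ha, ← map_nsmul, ← AddSubgroupClass.coe_nsmul, hx0, ZeroMemClass.coe_zero,
        map_zero]
    obtain ⟨n, hn⟩ := (hker _).mp hux
    rw [Units.val_pow_eq_pow_val] at hn
    set σ' : L →* L := (absoluteGaloisGroup.toAlgEquiv Kv σ : L →* L) with hσ'
    refine ⟨Units.map σ' u * u⁻¹, ⟨k, ?_⟩, ?_⟩
    · rw [Units.val_mul, mul_pow, Units.val_inv_eq_inv_val, inv_pow, Units.coe_map, ← map_pow, hn, hσ',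
        MonoidHom.coe_coe, map_zpow₀, AlgEquiv.commutes, mul_inv_cancel₀]
      exact zpow_ne_zero n ((_root_.map_ne_zero _).mpr hq0)
    · rw [AddSubgroupClass.coe_sub, map_sub, primaryComponent.coe_smul, ← resGal_eq_absGaloisRestrict,
        pointsMap_smul, ← ha, hequiv, ofMul_mul, ofMul_inv, map_add, map_neg, sub_eq_add_neg]
  -- (F2) no non-zero point of `A` is fixed by `H_v = ker κ ⊓ D_v`
  -- first for `p`-torsion points (tame transfer to `D_v`, then `Γ_{K_v}`-fixed points of `Φ` come from `K_vˣ`)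
  -- `q^m = 1` in `K̄_v` forces `m = 0` (`0 < v(q) < 1`)
  have hqpow : ∀ m : ℤ, algebraMap Kv L q ^ m = 1 → m = 0 := by
    intro m hm
    have hm' : q ^ m = 1 := (algebraMap Kv L).injective (by rw [map_zpow₀, hm, map_one])
    have h0 : (0 : WithZero (Multiplicative ℤ)) < Valued.v q :=
      zero_lt_iff.mpr ((Valuation.ne_zero_iff _).mpr hq0)
    have h1 : (Valued.v q) ^ m = (Valued.v q) ^ (0 : ℤ) := by rw [← map_zpow₀, hm', map_one, zpow_zero]
    exact (zpow_right_strictAnti₀ h0 hqv1).injective h1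
  have hinj := pointsMapOfEmb_injective W (closureEmb (K := K) Kv)
  -- (F2) no non-zero point of `A` is fixed by `H_v = ker κ ⊓ D_v`; first for `p`-torsion points: the `μ_p`-line is TAME
  -- (`σζ = ζ^c`, `σ^{p-1}` acts trivially), so such a point is `D_v`-fixed by the tame transfer of `…SharpTame`, and then
  -- `Φ(ζ)` is `Γ_{K_v}`-fixed, `= Φ(u)`, `u ∈ K_vˣ`, `ζ = u qⁿ ∈ K_v`, `ζ = 1` by `μ_p(K_v) = 1`
  have hF2p : ∀ a ∈ A, p • a = 0 → (∀ τ ∈ κ.kerSubgroup ⊓ decomp v, τ • a = a) → a = 0 := by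
    intro a haA hpa hfix
    obtain ⟨ζ, ⟨k, hζk⟩, hζ⟩ := haA
    -- `ζ^p = 1`
    have hζp : (ζ : L) ^ p = 1 := by
      have h0 : Φ (Additive.ofMul (ζ ^ p)) = 0 := by
        rw [ofMul_pow, map_nsmul, ← hζ, ← map_nsmul, ← AddSubgroupClass.coe_nsmul, hpa, ZeroMemClass.coe_zero,
          map_zero]
      obtain ⟨n, hn⟩ := (hker _).mp h0
      rw [Units.val_pow_eq_pow_val] at hn
      have h1 : algebraMap Kv L q ^ (n * (p ^ k : ℕ)) = 1 := by
        rw [zpow_mul, zpow_natCast, ← hn, ← pow_mul, mul_comm, pow_mul, hζk, one_pow]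
      have hn0 : n = 0 := by
        rcases mul_eq_zero.mp (hqpow _ h1) with h | h
        · exact h
        · exact absurd h (by exact_mod_cast pow_ne_zero k hp.ne_zero)
      rw [hn, hn0, zpow_zero]
    have hζup : ζ ^ p = 1 := Units.ext (by rw [Units.val_pow_eq_pow_val, hζp, Units.val_one])
    -- `ζ = 1` gives `a = 0`
    have hdone : (ζ : L) = 1 → a = 0 := fun hζ1 ↦ by
      have hpa0 : pointsMap W Kv (a : geomPoints W) = 0 := by
        rw [hζ, show ζ = 1 from Units.ext hζ1, ofMul_one, map_zero]
      have ha0 : (a : geomPoints W) = 0 := hinj (by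
        change pointsMap W Kv (a : geomPoints W) = pointsMap W Kv 0
        rw [hpa0, map_zero])
      exact Subtype.ext (by rw [ha0, ZeroMemClass.coe_zero])
    by_cases hζ1 : (ζ : L) = 1
    · exact hdone hζ1
    exfalso
    have hprim : IsPrimitiveRoot (ζ : L) p :=
      isPrimitiveRoot_of_mem_nthRootsFinset hp (by rw [Polynomial.mem_nthRootsFinset hp.pos]; exact hζp) hζ1
    -- tame transfer on the `μ_p`-line: `a` is `D_v`-fixed
    have hDfix : ∀ σ ∈ decomp v, σ • a = a := by
      intro σ hσ
      obtain ⟨σv, rfl⟩ := (mem_decomp_iff v σ).mp hσ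
      set σ' : L →* L := (absoluteGaloisGroup.toAlgEquiv Kv σv : L →* L) with hσ'
      have hξ : (σ' ζ) ^ p = 1 := by rw [← map_pow, hζp, map_one]
      obtain ⟨c, -, hc⟩ := hprim.eq_pow_of_pow_eq_one hξ
      have hc0 : ¬ p ∣ c := by
        rintro ⟨d, rfl⟩
        apply hζ1
        have h1 : σ' ζ = σ' 1 := by rw [← hc, pow_mul, hζp, one_pow, map_one]
        exact (absoluteGaloisGroup.toAlgEquiv Kv σv).injective h1
      have hmapζ : Units.map σ' ζ = ζ ^ c := Units.ext (by rw [Units.coe_map, Units.val_pow_eq_pow_val, hc])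
      -- the orbit: `σ^j • a ↦ Φ(ζ^{c^j})`
      have hps : ∀ Q : geomPoints W, pointsMap W Kv (absGaloisRestrict K Kv σv • Q) = σv • pointsMap W Kv Q :=
        fun Q ↦ by rw [← resGal_eq_absGaloisRestrict]; exact pointsMap_smul W Kv σv Q
      have hiter : ∀ j : ℕ, pointsMap W Kv (((absGaloisRestrict K Kv σv) ^ j • a : geomPrimaryTorsion W p) :
          geomPoints W) = Φ (Additive.ofMul (ζ ^ c ^ j)) := by
        intro j
        induction j with
        | zero => rw [pow_zero, one_smul, pow_zero, pow_one, hζ]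
        | succ j ih =>
          rw [pow_succ', mul_smul, primaryComponent.coe_smul, hps, ih, hequiv, map_pow, hmapζ, ← pow_mul, ← pow_succ']
      -- `c^{p-1} ≡ 1 (mod p)`, so `σ^{p-1}` fixes `a`
      have hcp : c ^ (p - 1) % p = 1 := by
        have := Nat.ModEq.pow_card_sub_one_eq_one hp ((Nat.Prime.coprime_iff_not_dvd hp).mpr hc0).symm
        rw [Nat.ModEq, Nat.mod_eq_of_lt hp.one_lt] at this
        exact this
      have hζc : ζ ^ c ^ (p - 1) = ζ := by
        rw [← Nat.div_add_mod (c ^ (p - 1)) p, hcp, pow_add, pow_mul, hζup, one_pow, one_mul, pow_one]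
      have hfixpow : (absGaloisRestrict K Kv σv) ^ (p - 1) • a = a := by
        apply Subtype.ext
        apply hinj
        change pointsMap W Kv _ = pointsMap W Kv _
        rw [hiter, hζc, hζ]
      exact geomPrimaryTorsion_smul_eq_of_forall_kerSubgroup_inf_decomp W κ v a hfix ⟨σv, rfl⟩
        ((Nat.coprime_self_sub_right hp.one_le).mpr (Nat.coprime_one_right _)) hfixpow
    -- `Φ(ζ)` is `Γ_{K_v}`-fixed, hence `Φ(u)` for `u ∈ K_vˣ`
    have hfixloc : ∀ σ : absoluteGaloisGroup Kv, σ • pointsMap W Kv (a : geomPoints W) =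
        pointsMap W Kv (a : geomPoints W) := by
      intro σ
      have h := hDfix (absGaloisRestrict K Kv σ) ⟨σ, rfl⟩
      rw [← pointsMap_smul, resGal_eq_absGaloisRestrict, ← primaryComponent.coe_smul, h]
    obtain ⟨u, hu⟩ := hrat _ hfixloc
    have h0 : Φ (Additive.ofMul (ζ * (Units.map (algebraMap Kv L : Kv →* L) u)⁻¹)) = 0 := by
      rw [ofMul_mul, ofMul_inv, map_add, map_neg, hu, ← hζ, add_neg_cancel]
    obtain ⟨n, hn⟩ := (hker _).mp h0
    have hU0 : algebraMap Kv L (u : Kv) ≠ 0 := (_root_.map_ne_zero _).mpr u.ne_zero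
    have hζeq : (ζ : L) = algebraMap Kv L ((u : Kv) * q ^ n) := by
      rw [map_mul, map_zpow₀, ← hn, Units.val_mul, Units.val_inv_eq_inv_val, Units.coe_map,
        MonoidHom.coe_coe, mul_left_comm, mul_inv_cancel₀ hU0, mul_one]
    have hζ0 : ((u : Kv) * q ^ n) ^ p = 1 := by
      apply (algebraMap Kv L).injective
      rw [map_pow, ← hζeq, hζp, map_one]
    exact hζ1 (by rw [hζeq, hμ _ hζ0, map_one])
  -- then for all of `A` by induction on the exponent (`A` is stable under multiplication by `p`)
  have hF2 : ∀ a ∈ A, (∀ τ ∈ κ.kerSubgroup ⊓ decomp v, τ • a = a) → a = 0 := by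
    intro a haA hfix
    obtain ⟨j, hj⟩ := a.2
    have hpj : p ^ j • a = 0 := Subtype.ext (by rw [AddSubgroupClass.coe_nsmul, hj]; rfl)
    clear hj
    induction j generalizing a with
    | zero => simpa using hpj
    | succ j ih =>
      have hb : p • (p ^ j • a) = 0 := by rw [← mul_nsmul', ← pow_succ', hpj]
      have hbA : p ^ j • a ∈ A := by
        obtain ⟨ζ, ⟨k, hζk⟩, hζ⟩ := haA
        refine ⟨ζ ^ p ^ j, ⟨k, by rw [Units.val_pow_eq_pow_val, ← pow_mul, mul_comm, pow_mul, hζk, one_pow]⟩, ?_⟩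
        rw [AddSubgroupClass.coe_nsmul, map_nsmul, hζ, ← map_nsmul, ofMul_pow]
      have hbfix : ∀ τ ∈ κ.kerSubgroup ⊓ decomp v, τ • (p ^ j • a) = p ^ j • a := fun τ hτ ↦ by
        rw [smul_comm, hfix τ hτ]
      have hb0 : p ^ j • a = 0 := hF2p _ hbA hb hbfix
      exact ih a haA hfix hb0
  -- conclude by §1
  refine smul_eq_of_fixed_inf_of_sub_mem κ.kerSubgroup (decomp v) (fun d hd n hn ↦ ?_) A hF2
    (fun d hd ↦ hF1 d hd P) hP
  refine ⟨?_, (decomp v).mul_mem ((decomp v).mul_mem ((decomp v).inv_mem hd) hn.2) hd⟩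
  have := Subgroup.Normal.conj_mem (inferInstanceAs κ.kerSubgroup.Normal) n hn.1 d⁻¹
  simpa using this


/-- **`E[p^∞]^{Gal(K̄/K_∞) ⊓ D_v} = E[p^∞]^{D_v}`** at a split multiplicative place with `μ_p(K_v) = 1`, any curve, any `κ` (iff
form). [cite: SilvermanATAEC1994, Thm. V.5.3] [cite: GreenbergLNM1716, §3 Lemma 3.3] -/
theorem geomPrimaryTorsion_fixed_kerSubgroup_inf_decomp_iff_of_split_any (v : HeightOneSpectrum (𝓞 K))
    (hsplit : W.HasSplitMultiplicativeReductionAt v) (hμ : ∀ ζ : v.adicCompletion K, ζ ^ p = 1 → ζ = 1)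
    (P : geomPrimaryTorsion W p) :
    (∀ τ ∈ κ.kerSubgroup ⊓ decomp v, τ • P = P) ↔ ∀ σ ∈ decomp v, σ • P = P :=
  ⟨geomPrimaryTorsion_forall_decomp_smul_eq_of_split_any W κ v hsplit hμ P, fun h τ hτ ↦ h τ hτ.2⟩

/-- **`E[p]^{Gal(K̄/K_∞) ⊓ D_v} = E[p]^{D_v} = E(K_v)[p]`** at a split multiplicative place with `μ_p(K_v) = 1`, any curve, any
`κ` (the `p`-torsion case, via the inclusion `E[p] ≤ E[p^∞]`). [cite: SilvermanATAEC1994, Thm. V.5.3] [cite: GreenbergLNM1716, §3 Lemma 3.3] -/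
theorem geomTorsion_fixed_kerSubgroup_inf_decomp_iff_of_split_any (v : HeightOneSpectrum (𝓞 K))
    (hsplit : W.HasSplitMultiplicativeReductionAt v) (hμ : ∀ ζ : v.adicCompletion K, ζ ^ p = 1 → ζ = 1)
    (P : geomTorsion W (p : ℤ)) :
    (∀ τ ∈ κ.kerSubgroup ⊓ decomp v, τ • P = P) ↔ ∀ σ ∈ decomp v, σ • P = P := by
  set m : W.geomPrimaryTorsion p := AddSubgroup.inclusion (geomTorsion_le_geomPrimaryTorsion W p) P with hm
  have key : ∀ g : absoluteGaloisGroup K, g • P = P ↔ g • m = m := fun g ↦ by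
    constructor
    · intro h; apply Subtype.ext
      change g • (P : geomPoints W) = (P : geomPoints W)
      rw [← Literature.NumberTheory.EllipticCurves.AddSubgroup.torsionBy.coe_smul, h]
    · intro h; apply Subtype.ext
      have := congrArg (fun z : W.geomPrimaryTorsion p ↦ (z : geomPoints W)) h
      simpa [hm, primaryComponent.coe_smul] using this
  simp only [key]
  exact geomPrimaryTorsion_fixed_kerSubgroup_inf_decomp_iff_of_split_any W κ v hsplit hμ m

/-- **THE ♯-CLAUSE AT A SPLIT MULTIPLICATIVE PLACE, EXPLICIT — ANY CURVE: `y_v = ∂b + χ`.**  Split multiplicative `v`,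
`μ_p(K_v) = 1`, `y ∈ H¹(Γ_K, E[p])` with `ι_v(res_{H_v} y) = 0` (clause (b) of `…SharpLocal`, `H_v = Gal(K̄/K_∞) ⊓ D_v`).  For every
cocycle `ψ` on `D_v` representing `y_v = res_{D_v} y` there are `b ∈ E[p^∞]` with `p·b` FIXED BY `D_v` and `χ : D_v → E[p^∞]`
ADDITIVE, with `D_v`-FIXED `p`-TORSION values, VANISHING on `H_v`, such that `ψ(σ) = (σ•b − b) + χ(σ)` on `D_v`.  Verbatim
p617184's proof with both uses of tameness replaced by the first theorem (`p·b` and the values of `χ = ψ − ∂b` are `H_v`-fixed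
points of `E[p^∞]`). [cite: GreenbergLNM1716, §3 Lemmas 3.1, 3.3] [cite: SilvermanATAEC1994, Thm. V.5.3] [cite: SerreGaloisCohomology1997, I.§2.6 (b)] -/
theorem exists_kummer_add_hom_of_sharp_clause_of_split_any (v : HeightOneSpectrum (𝓞 K))
    (hsplit : W.HasSplitMultiplicativeReductionAt v)
    (hμ : ∀ ζ : v.adicCompletion K, ζ ^ p = 1 → ζ = 1)
    (y : discreteH1 (absoluteGaloisGroup K) (geomTorsion W (p : ℤ)))
    (hy : W.torsionToPrimaryH1Sub p (κ.kerSubgroup ⊓ decomp v)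
      (ResKernel.resSubgroup (κ.kerSubgroup ⊓ decomp v) (geomTorsion W (p : ℤ)) y) = 0)
    (ψ : contOneCocycles (discreteTopRep (decomp v) (geomTorsion W (p : ℤ))))
    (hψ : oneCocycleClass _ ψ = ResKernel.resSubgroup (decomp v) (geomTorsion W (p : ℤ)) y) :
    ∃ (b : geomPrimaryTorsion W p) (χ : decomp v → geomPrimaryTorsion W p),
      (∀ σ ∈ decomp v, σ • (p • b) = p • b) ∧
      (∀ σ : decomp v, AddSubgroup.inclusion (geomTorsion_le_geomPrimaryTorsion W p) (ψ.1 σ) =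
        ((σ : absoluteGaloisGroup K) • b - b) + χ σ) ∧
      (∀ σ τ : decomp v, χ (σ * τ) = χ σ + χ τ) ∧
      (∀ σ : decomp v, ∀ d ∈ decomp v, d • χ σ = χ σ) ∧
      (∀ σ : decomp v, p • χ σ = 0) ∧
      (∀ σ : decomp v, (σ : absoluteGaloisGroup K) ∈ κ.kerSubgroup → χ σ = 0) := by
  set incl := AddSubgroup.inclusion (geomTorsion_le_geomPrimaryTorsion W p) with hincl
  have hle : κ.kerSubgroup ⊓ decomp v ≤ decomp v := inf_le_right
  -- the restriction of `ψ` to `H_v = ker κ ⊓ D_v`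
  set φ := contOneCocycles.pullback (subgroupInclusion hle)
    (resHomOfEquivariant (subgroupInclusion hle) (AddMonoidHom.id _) (fun _ _ ↦ rfl)) ψ with hφdef
  have hφval : ∀ x : (κ.kerSubgroup ⊓ decomp v : Subgroup (absoluteGaloisGroup K)),
      φ.1 x = ψ.1 (Subgroup.inclusion hle x) := fun x ↦ rfl
  have hφclass : oneCocycleClass _ φ =
      ResKernel.resSubgroup (κ.kerSubgroup ⊓ decomp v) (geomTorsion W (p : ℤ)) y := by
    rw [← ZpDescent.resOfLe_resSubgroup hle y, ← hψ]
    change _ = ContinuousCohomology.map _ _ 1 (oneCocycleClass _ ψ)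
    rw [map_oneCocycleClass]
  -- Kummer form of the clause on `H_v`
  obtain ⟨b, hbfix, hbval⟩ := exists_kummer_of_torsionToPrimaryH1Sub_eq_zero W p (κ.kerSubgroup ⊓ decomp v) φ
    (by rw [hφclass]; exact hy)
  -- `p • b` is `D_v`-fixed (tower torsion = level-0 torsion at a split place)
  have hpb : ∀ σ ∈ decomp v, σ • (p • b) = p • b :=
    geomPrimaryTorsion_forall_decomp_smul_eq_of_split_any W κ v hsplit hμ (p • b)
      (fun τ hτ ↦ hbfix ⟨τ, hτ⟩)
  set χ : decomp v → geomPrimaryTorsion W p := fun σ ↦ incl (ψ.1 σ) - ((σ : absoluteGaloisGroup K) • b - b)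
    with hχ
  have hψχ : ∀ σ : decomp v, incl (ψ.1 σ) = ((σ : absoluteGaloisGroup K) • b - b) + χ σ := fun σ ↦ by
    rw [hχ]; exact (add_sub_cancel _ _).symm
  -- `χ` vanishes on `H_v`
  have hχker : ∀ σ : decomp v, (σ : absoluteGaloisGroup K) ∈ κ.kerSubgroup → χ σ = 0 := by
    intro σ hσ
    have h := hbval ⟨σ, ⟨hσ, σ.2⟩⟩
    rw [hφval] at h
    have h' : incl (ψ.1 σ) = (σ : absoluteGaloisGroup K) • b - b := Subtype.ext (by
      rw [hincl, AddSubgroup.coe_inclusion]; exact h)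
    rw [hχ]
    exact sub_eq_zero.mpr h'
  -- `χ` is `p`-torsion
  have hχp : ∀ σ : decomp v, p • χ σ = 0 := by
    intro σ
    have h1 : p • incl (ψ.1 σ) = 0 := by
      rw [← map_nsmul]
      have : p • ψ.1 σ = 0 := Subtype.ext (by
        rw [AddSubgroupClass.coe_nsmul, ZeroMemClass.coe_zero]
        exact AddSubgroup.torsionBy.nsmul_iff.mp (ψ.1 σ).2)
      rw [this, map_zero]
    have h2 : p • ((σ : absoluteGaloisGroup K) • b - b) = 0 := by
      rw [smul_sub, smul_comm, hpb _ σ.2, sub_self]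
    rw [hχ]
    change p • (incl (ψ.1 σ) - ((σ : absoluteGaloisGroup K) • b - b)) = 0
    rw [smul_sub, h1, h2, sub_zero]
  -- twisted additivity of `χ` (both `ψ` and `σ ↦ σ•b − b` are cocycles)
  have hχcoc : ∀ σ τ : decomp v, χ (σ * τ) = χ σ + (σ : absoluteGaloisGroup K) • χ τ := by
    intro σ τ
    have hc := ψ.2 σ τ
    have hc' : incl (ψ.1 (σ * τ)) = incl (ψ.1 σ) + (σ : absoluteGaloisGroup K) • incl (ψ.1 τ) := by
      rw [hc, map_add]
      congr 1
    rw [hχ]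
    change incl (ψ.1 (σ * τ)) - (((σ * τ : decomp v) : absoluteGaloisGroup K) • b - b) =
      (incl (ψ.1 σ) - ((σ : absoluteGaloisGroup K) • b - b)) +
        (σ : absoluteGaloisGroup K) • (incl (ψ.1 τ) - ((τ : absoluteGaloisGroup K) • b - b))
    rw [hc', Subgroup.coe_mul, mul_smul, smul_sub, smul_sub]
    abel
  -- values of `χ` are `H_v`-fixed, hence `D_v`-fixed (tame transfer on `E[p]`)
  have hχfix : ∀ σ : decomp v, ∀ d ∈ decomp v, d • χ σ = χ σ := by
    intro σ d hd
    have hHfix : ∀ τ ∈ κ.kerSubgroup ⊓ decomp v, τ • χ σ = χ σ := by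
      intro τ hτ
      -- `τ σ = σ (σ⁻¹ τ σ)` with `σ⁻¹ τ σ ∈ H_v`
      have hτ' : ((σ : absoluteGaloisGroup K))⁻¹ * τ * σ ∈ κ.kerSubgroup ⊓ decomp v := by
        refine ⟨?_, (decomp v).mul_mem ((decomp v).mul_mem ((decomp v).inv_mem σ.2) hτ.2) σ.2⟩
        have := Subgroup.Normal.conj_mem (inferInstanceAs κ.kerSubgroup.Normal) τ hτ.1 (σ : absoluteGaloisGroup K)⁻¹
        simpa using this
      have h1 := hχcoc ⟨τ, hτ.2⟩ σ
      have h2 := hχcoc σ ⟨(σ : absoluteGaloisGroup K)⁻¹ * τ * σ, hτ'.2⟩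
      have heq : (⟨τ, hτ.2⟩ : decomp v) * σ = σ * ⟨(σ : absoluteGaloisGroup K)⁻¹ * τ * σ, hτ'.2⟩ :=
        Subtype.ext (by simp [mul_assoc])
      rw [heq, h2, hχker ⟨_, hτ'.2⟩ hτ'.1, hχker ⟨τ, hτ.2⟩ hτ.1, smul_zero, add_zero, zero_add] at h1
      exact h1.symm
    exact geomPrimaryTorsion_forall_decomp_smul_eq_of_split_any W κ v hsplit hμ (χ σ) hHfix d hd
  refine ⟨b, χ, hpb, hψχ, fun σ τ ↦ ?_, hχfix, hχp, hχker⟩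
  rw [hχcoc, hχfix τ σ σ.2]


end SplitAny

end Summit.BirchSwinnertonDyer.BirchSwinnertonDyer.Theorems.UpperNonSurjThreeSharp

end
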